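import Summits.AtomisticToContinuum.Crystallization.Theorems.FreeSplittingCertificatesStrictSplittingRuleP1LedgerGauge

/-!
# `StrictSplittingRule` (stmt-AtomisticToContinuum-12560): the gauge substitution is a PROJECTION ONTO the least-squares constraint set (P1 interpolant object, part 110)

Route `FreeSplittingCertificates`, crux r3 `StrictSplittingRule` (H12⋆ = `stub_coreJointCoercive`), unit b2b-freesplit-B gen 52.
VALUE = a structural check of part 106's explicit least-squares co-rotation (HOME CERT §49): `p1Vals a h p (p1StarAt p)` maps EVERY displacement field
into the constraint set of (NC∃′) — value `0` at `p` and the first-shell moment condition `Σ_{q ∈ shell} (y_q − y_p) × v_q = 0` (the normal equations of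
the least-squares fit: `Σ d × v = m(u) − J·J⁻¹m(u) = 0`, `p1LSMoment_p1Vals`), equivalently the antisymmetric-matrix form the endpoints use
(`p1Vals_moment`) — and is the identity there (`p1Vals_eq_self`, part 106): it is a linear projection onto the constraint set along the rigid rotations.
Hence the constrained near certificate (NC∃′) and the unconstrained gauged form are interchangeable (`nearForm_gauged_nonneg_of_constrained`).
NOT a proof of H12⋆, NOT summit progress.  [folklore: least squares normal equations]
-/

noncomputable section

open scoped BigOperators Matrix
open Finset

namespace Summit.AtomisticToContinuum.Crystallization.Theorems.StrictSplittingRuleBirth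

open Literature.MathematicalPhysics.StatisticalMechanics
open Summit.AtomisticToContinuum.Crystallization.Theorems.PalmUnimodularRigidity.LayeredLawsSelectHcp

/-- The gauge values vanish at the base site. -/
theorem p1Vals_apply_self (a h : ℝ) (p : ℤ × ℤ × ℤ) (SH : Finset (ℤ × ℤ × ℤ)) (u : ℤ × ℤ × ℤ → (Fin 3 → ℝ)) :
    p1Vals a h p SH u p = 0 := by
  simp only [p1Vals, p1Rel_self, map_zero, sub_self]

/-- **Normal equations**: the least-squares moment of the gauge values over the shell of `p` vanishes, `Σ_{q∈shell} (y_q − y_p) × v_q(u) = m(u) − J·J⁻¹·m(u) = 0`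
(needs `a ≠ 0`). [folklore] -/
theorem p1LSMoment_p1Vals {a h : ℝ} (ha : 0 < a) (p : ℤ × ℤ × ℤ) (u : ℤ × ℤ × ℤ → (Fin 3 → ℝ)) :
    p1LSMoment a h p (p1StarAt p) (p1Vals a h p (p1StarAt p) u) = 0 := by
  have hJ1 : (4 * a ^ 2 + 6 * h ^ 2) ≠ 0 := by positivity
  have hJ2 : (8 * a ^ 2) ≠ 0 := by positivity
  set θ := p1LSTheta a h p (p1StarAt p) u with hθ
  have key := p1StarAt_cross_cross a h p θ
  -- Σ d × v = Σ d × (u_q − u_p) − Σ d × (θ × d)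
  have e : p1LSMoment a h p (p1StarAt p) (p1Vals a h p (p1StarAt p) u) =
      p1LSMoment a h p (p1StarAt p) u - ∑ q ∈ p1StarAt p, (p1Rel a h p q) ⨯₃ (θ ⨯₃ (p1Rel a h p q)) := by
    unfold p1LSMoment
    rw [← Finset.sum_sub_distrib]
    refine Finset.sum_congr rfl fun q _ => ?_
    have ev : p1Vals a h p (p1StarAt p) u q - p1Vals a h p (p1StarAt p) u p = (u q - u p) - θ ⨯₃ (p1Rel a h p q) := by
      rw [p1Vals_apply_self, sub_zero]
      simp only [p1Vals, hθ]
    rw [ev, map_sub]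
  rw [e, key]
  funext k
  simp only [Pi.sub_apply, Pi.zero_apply, hθ, p1LSTheta]
  fin_cases k
  · simp only [Fin.zero_eta, Fin.isValue, Matrix.cons_val_zero]
    rw [if_neg (by decide)]; field_simp; ring
  · simp only [Fin.mk_one, Fin.isValue, Matrix.cons_val_one, Matrix.cons_val_zero]
    rw [if_neg (by decide)]; field_simp; ring
  · simp only [Fin.reduceFinMk, Fin.isValue, Matrix.cons_val, if_true]
    field_simp; ring

/-- **Moment condition in the endpoints' form**: for every antisymmetric `Z`, `Σ_{q∈shell} Σ_k v_q,k (Σ_j (y_q − y_p)_j Z_jk) = 0` for the gauge values `v = p1Vals u`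
(the sum is `Z₁₂·M₀ − Z₀₂·M₁ + Z₀₁·M₂` in terms of the cross-product moment `M = Σ d × v = 0`). [folklore] -/
theorem p1Vals_moment {a h : ℝ} (ha : 0 < a) (p : ℤ × ℤ × ℤ) (u : ℤ × ℤ × ℤ → (Fin 3 → ℝ))
    (Z : Fin 3 → Fin 3 → ℝ) (hZ : ∀ j k, Z j k = -Z k j) :
    ∑ q ∈ p1StarAt p, ∑ k : Fin 3, p1Vals a h p (p1StarAt p) u q k *
      (∑ j : Fin 3, (hcpSite a h q j - hcpSite a h p j) * Z j k) = 0 := by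
  have hM := p1LSMoment_p1Vals (h := h) ha p u
  have h0 := congrFun hM 0
  have h1 := congrFun hM 1
  have h2 := congrFun hM 2
  have hVp : p1Vals a h p (p1StarAt p) u p = 0 := p1Vals_apply_self a h p _ u
  unfold p1LSMoment at h0 h1 h2
  rw [Finset.sum_apply] at h0 h1 h2
  simp only [cross_apply, Fin.isValue, Matrix.cons_val_zero, Matrix.cons_val_one, Matrix.cons_val, Pi.zero_apply, p1Rel, hVp, sub_zero] at h0 h1 h2
  have z00 : Z 0 0 = 0 := by have := hZ 0 0; linarith
  have z11 : Z 1 1 = 0 := by have := hZ 1 1; linarith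
  have z22 : Z 2 2 = 0 := by have := hZ 2 2; linarith
  have z10 : Z 1 0 = -Z 0 1 := hZ 1 0
  have z20 : Z 2 0 = -Z 0 2 := hZ 2 0
  have z21 : Z 2 1 = -Z 1 2 := hZ 2 1
  set V := p1Vals a h p (p1StarAt p) u with hV
  have e : ∀ q : ℤ × ℤ × ℤ, ∑ k : Fin 3, V q k * (∑ j : Fin 3, (hcpSite a h q j - hcpSite a h p j) * Z j k) =
      Z 1 2 * ((hcpSite a h q 1 - hcpSite a h p 1) * V q 2 - (hcpSite a h q 2 - hcpSite a h p 2) * V q 1) -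
      Z 0 2 * ((hcpSite a h q 2 - hcpSite a h p 2) * V q 0 - (hcpSite a h q 0 - hcpSite a h p 0) * V q 2) +
      Z 0 1 * ((hcpSite a h q 0 - hcpSite a h p 0) * V q 1 - (hcpSite a h q 1 - hcpSite a h p 1) * V q 0) := by
    intro q
    simp only [Fin.sum_univ_three, Fin.isValue, z00, z11, z22, z10, z20, z21]
    ring
  rw [Finset.sum_congr rfl fun q _ => e q, Finset.sum_add_distrib, Finset.sum_sub_distrib, ← Finset.mul_sum, ← Finset.mul_sum,
    ← Finset.mul_sum, h0, h1, h2]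
  ring

/-- **The gauge substitution lands in the constraint set, so the constrained near certificate gives the gauged one**: if a functional `Q` of the lattice
values is `≥ 0` on the least-squares constraint set at `p` (value `0` at `p`, moment condition — the shape of (NC∃′)), then `0 ≤ Q (p1Vals a h p (p1StarAt p) u)`
for EVERY field `u`.  (Converse direction of part 107's use of `p1Vals_eq_self`.) [folklore] -/
theorem nearForm_gauged_nonneg_of_constrained {a h : ℝ} (ha : 0 < a) (p : ℤ × ℤ × ℤ) (Q : (ℤ × ℤ × ℤ → (Fin 3 → ℝ)) → ℝ)
    (hQ : ∀ V : ℤ × ℤ × ℤ → (Fin 3 → ℝ), V p = 0 →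
      (∀ Z : Fin 3 → Fin 3 → ℝ, (∀ j k, Z j k = -Z k j) →
        ∑ q ∈ p1StarAt p, ∑ k : Fin 3, V q k * (∑ j : Fin 3, (hcpSite a h q j - hcpSite a h p j) * Z j k) = 0) → 0 ≤ Q V)
    (u : ℤ × ℤ × ℤ → (Fin 3 → ℝ)) :
    0 ≤ Q (p1Vals a h p (p1StarAt p) u) :=
  hQ _ (p1Vals_apply_self a h p _ u) (fun Z hZ => p1Vals_moment (h := h) ha p u Z hZ)

end Summit.AtomisticToContinuum.Crystallization.Theorems.StrictSplittingRuleBirth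

end
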